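import Mathlib.Analysis.SpecialFunctions.Log.Basic
import Mathlib.Analysis.SpecialFunctions.Exp

/-!
# Crux `UniformPhotonSphereChannels` (K1), negative side — the geometry of the witness packet
# on the Rindler chart (pure real arithmetic)

Support file of the standing disprover of item stmt-FinalStateConjecture-10045.  With the surface
gravity `κ = 1/4M`, the chart radius `X(x) = e^{κx}/κ` and the packet placed at tortoise
positions `x_l = −ρ − 4M/5 < s_l = −ρ − 7M/10 < s_r = −ρ − M/2 < x_r = −ρ − 2M/5 < x_e = −ρ`, the
chart radii are fixed fractions of `X_e = X(−ρ) = 4M e^{−ρ/4M}` (`X_l = e^{−1/5}X_e ≥ (4/5)X_e`,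
`X_r = e^{−1/10}X_e ≥ (9/10)X_e`, …), and the end points of the tortoise slice `t = t₁ = 2M log 3`
(the ray `T = X/2`) through `X₀ = 2X_l/3` and `X_* = 2X_e/3` are `x_l − t₁` and `−ρ − t₁`
(`geometry`). [folklore]
-/

namespace Summit.FinalStateConjecture.FinalStateConjecture.Theorems

noncomputable section

namespace WaveDefect

/-- `e^{-a} ≥ 1 - a`. -/
theorem one_sub_le_exp_neg (a : ℝ) : 1 - a ≤ Real.exp (-a) := by
  have := Real.add_one_le_exp (-a); linarith

/-- **Geometry of the witness packet on the Rindler chart.** -/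
theorem geometry {M : ℝ} (hM : 0 < M) (ρ : ℝ) {κ Xe Xm Xsl Xsr Xp : ℝ} (hκ : κ = 1 / (4 * M))
    (hXe : Xe = Real.exp (κ * -ρ) / κ) (hXm : Xm = Real.exp (κ * (-ρ - 4 / 5 * M)) / κ)
    (hXsl : Xsl = Real.exp (κ * (-ρ - 7 / 10 * M)) / κ)
    (hXsr : Xsr = Real.exp (κ * (-ρ - 1 / 2 * M)) / κ)
    (hXp : Xp = Real.exp (κ * (-ρ - 2 / 5 * M)) / κ) :
    0 < κ ∧ 0 < Xe ∧ 4 / 5 * Xe ≤ Xm ∧ Xm < Xsl ∧ Xsl < Xsr ∧ Xsr < Xp ∧ Xp < Xe ∧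
    9 / 10 * Xe ≤ Xp ∧ κ * Xm = Real.exp (κ * (-ρ - 4 / 5 * M)) ∧ κ * Xe = Real.exp (κ * -ρ) ∧
    (Real.log (κ * ((2 / 3 * Xm) * (1 + 1 / 2))) + Real.log (κ * ((2 / 3 * Xm) * (1 - 1 / 2))))
        / (2 * κ) = (-ρ - 4 / 5 * M) - Real.log 3 / (2 * κ) ∧
    (Real.log (κ * ((2 / 3 * Xe) * (1 + 1 / 2))) + Real.log (κ * ((2 / 3 * Xe) * (1 - 1 / 2))))
        / (2 * κ) = -ρ - Real.log 3 / (2 * κ) ∧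
    Real.log ((1 + 1 / 2) / (1 - 1 / 2)) = Real.log 3 := by
  have hκpos : 0 < κ := by rw [hκ]; positivity
  have hκM : κ * M = 1 / 4 := by rw [hκ]; field_simp
  -- every chart radius is `e^{-a} X_e`
  have hfrac : ∀ q : ℝ, Real.exp (κ * (-ρ - q * M)) / κ = Real.exp (-(q / 4)) * Xe := by
    intro q
    rw [hXe, show κ * (-ρ - q * M) = κ * -ρ + -(q / 4) by linear_combination (-q) * hκM,
      Real.exp_add]
    ring
  have hXe0 : 0 < Xe := by rw [hXe]; exact div_pos (Real.exp_pos _) hκpos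
  have hm : Xm = Real.exp (-(4 / 5 / 4)) * Xe := by rw [hXm, hfrac]
  have hsl : Xsl = Real.exp (-(7 / 10 / 4)) * Xe := by rw [hXsl, hfrac]
  have hsr : Xsr = Real.exp (-(1 / 2 / 4)) * Xe := by rw [hXsr, hfrac]
  have hp : Xp = Real.exp (-(2 / 5 / 4)) * Xe := by rw [hXp, hfrac]
  have hlt : ∀ a b : ℝ, a < b → Real.exp (-b) * Xe < Real.exp (-a) * Xe := fun a b hab =>
    mul_lt_mul_of_pos_right (Real.exp_lt_exp.mpr (by linarith)) hXe0
  have hκXm : κ * Xm = Real.exp (κ * (-ρ - 4 / 5 * M)) := by rw [hXm, mul_div_cancel₀ _ hκpos.ne']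
  have hκXe : κ * Xe = Real.exp (κ * -ρ) := by rw [hXe, mul_div_cancel₀ _ hκpos.ne']
  have h3 : (1 + 1 / 2 : ℝ) / (1 - 1 / 2) = 3 := by norm_num
  refine ⟨hκpos, hXe0, ?_, ?_, ?_, ?_, ?_, ?_, hκXm, hκXe, ?_, ?_, by rw [h3]⟩
  · rw [hm]
    have := one_sub_le_exp_neg (4 / 5 / 4 : ℝ)
    nlinarith
  · rw [hm, hsl]; exact hlt _ _ (by norm_num)
  · rw [hsl, hsr]; exact hlt _ _ (by norm_num)
  · rw [hsr, hp]; exact hlt _ _ (by norm_num)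
  · rw [hp]
    have : Real.exp (-(2 / 5 / 4 : ℝ)) < 1 := Real.exp_lt_one_iff.mpr (by norm_num)
    nlinarith
  · rw [hp]
    have := one_sub_le_exp_neg (2 / 5 / 4 : ℝ)
    nlinarith
  · -- the slice through `X₀ = 2X_l/3`
    have e1 : κ * ((2 / 3 * Xm) * (1 + 1 / 2)) = Real.exp (κ * (-ρ - 4 / 5 * M)) := by
      rw [← hκXm]; ring
    have e2 : κ * ((2 / 3 * Xm) * (1 - 1 / 2)) = Real.exp (κ * (-ρ - 4 / 5 * M)) / 3 := by
      rw [← hκXm]; ring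
    rw [e1, e2, Real.log_div (Real.exp_pos _).ne' (by norm_num), Real.log_exp]
    field_simp
    ring
  · have e1 : κ * ((2 / 3 * Xe) * (1 + 1 / 2)) = Real.exp (κ * -ρ) := by
      rw [← hκXe]; ring
    have e2 : κ * ((2 / 3 * Xe) * (1 - 1 / 2)) = Real.exp (κ * -ρ) / 3 := by
      rw [← hκXe]; ring
    rw [e1, e2, Real.log_div (Real.exp_pos _).ne' (by norm_num), Real.log_exp]
    field_simp
    ring

end WaveDefect

end

end Summit.FinalStateConjecture.FinalStateConjecture.Theorems
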